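import Summits.AtomisticToContinuum.HydrodynamicLimit.Theorems.TwoClocksEquilibriumShearWindowLD
import Summits.AtomisticToContinuum.HydrodynamicLimit.Theorems.TwoClocksEquilibriumShearWindowLDGossip
import Summits.AtomisticToContinuum.HydrodynamicLimit.Theorems.TwoClocksEquilibriumShearWindowLDAllWindows
import Summits.AtomisticToContinuum.HydrodynamicLimit.Theorems.TwoClocksEquilibriumShearWindowLDNormalForms

/-!
# `EquilibriumShearWindowLD` in probabilistic currency: Chernoff concentration of the window shear
# stress, and the typed refutation dock "slow stress mode ⇒ route kill"
# (route TwoClocks, stmt-AtomisticToContinuum-14446)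

Helper file (`--supports` stmt-AtomisticToContinuum-14446). The item
`TwoClocks.EquilibriumShearWindowLD` is an exponential-moment (pressure) statement: for the window
functional of the kinetic shear stress
`W_{N,τ}(z) = ∑ᵢ w⁻¹∫₀ʷ φ(xᵢ(r)) vᵢ⁰(r) vᵢ¹(r) dr`, `w = τ(N+1)^{-1/3}`, under the global canonical
Gibbs law `G_N` at rest, `∫ exp(β W_{N,τ}) dG_N ≤ exp(ε(N+1))` eventually in `N`, for all `|β| ≤ β₀`,
every `ε > 0` and a suitable `τ = τ(ε)`. The route's KILL CRITERIA ask refuters for "a hidden slow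
stress mode of the deterministic gas": a mechanism keeping a shear stress `δ` per particle alive over
every finite kinetic window at small probabilistic cost. This file types both directions of the
exponential Chebyshev (Chernoff) translation between the two currencies, so that MD / refuter seats
and the item speak about the same event:

* `measure_le_exp_neg_mul_lintegral_exp`, `measure_le_exp_of_lintegral_exp_le`: Chernoff's bound in
  `lintegral` currency (Markov's inequality `mul_meas_ge_le_lintegral₀` applied to `exp(β f)`).
* `equilibriumShearWindowLD_concentration`: the item implies EXPONENTIAL CONCENTRATION OF THE WINDOW
  SHEAR STRESS AT EVERY LINEAR SCALE with a rate LINEAR in the level: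
  `∃ c > 0 ∀ δ > 0 ∃ τ₀ ∀ τ ≥ τ₀ ∃ N₀ ∀ N ≥ N₀, G_N{|W_{N,τ}| ≥ δ(N+1)} ≤ 2 exp(-c δ (N+1))`
  (`c = β₀/2`; both tails at a common window by the all-windows form
  `equilibriumShearWindowLD_iff_allWindows` of seat c2 and the two tilts `±β₀`).
* `not_equilibriumShearWindowLD_of_slowStressMode`: conversely, a SLOW-STRESS-MODE WITNESS — at
  reduced diameters accumulating at `0`, some `a₀, θ₀, Φ, φ` such that for every `β > 0` there are a
  level `δ` and a cost rate `I < βδ` with `G_N{W_{N,τ} ≥ δ(N+1)} ≥ exp(-I(N+1))` for infinitely many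
  `N`, at EVERY window `τ > 0` — refutes the item. Read contrapositively this is the refuter's burden
  in numbers: sustained stress `δ` per particle at large-deviation cost `o(δ)` (cost/level below every
  positive tilt), uniformly over kinetic windows. All explicit scenarios audited by seats c0–c5
  (aligned streams: cost `3 log(1/d)` per particle; coherent clusters / hot particles: cost
  `≥ |V|²/(2θ₀)` against gain `≤ β|V|²/2`; shear waves of `k` mean free paths: net `β²θ₀²/(2k²)` with
  `k² ≳` the number of mean free times in the window) have cost/level bounded below or decaying gain,
  hence are not witnesses.
* `not_equilibriumFastWindowLD_of_slowStressMode`, `not_kineticWindowLDUniform_of_slowStressMode`,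
  `not_kineticCurrentsWindowLDUniform_of_slowStressMode`: the same witness kills the crux
  `EquilibriumFastWindowLD` (stmt-14440), the docking node `KineticWindowLDUniform` (stmt-14442) and
  the sibling node `OneFlightGossipEngine.KineticCurrentsWindowLDUniform` (stmt-14662), through the
  landed reductions (`equilibriumShearWindowLD_of_*`) — the typed form of the route's KILL edge
  "¬EquilibriumShearWindowLD closes the route and moots KineticCurrentsWindowLD-based plans".

Nothing dynamical is proved; the item (the `u₀ = 0`, `F = φ v⁰v¹` instance of the open crux
`EquilibriumFastWindowLD`) stays open.

References: S. Olla, S. R. S. Varadhan, H.-T. Yau, Comm. Math. Phys. 155 (1993) 523, §2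
(exponential Chebyshev step of the one-block estimate); A. Dembo, O. Zeitouni, *Large Deviations
Techniques and Applications* (1998), §2.2 (Chernoff bounds).

prover-pitem-stmt-AtomisticToContinuum-14446-c5-0.
-/

noncomputable section

open MeasureTheory Real Set
open scoped ENNReal

namespace Summit.AtomisticToContinuum.HydrodynamicLimit.Theorems

open Literature.Analysis.FluidPDE Literature.MathematicalPhysics.KineticTheory
open Summit.AtomisticToContinuum.HydrodynamicLimit.Theses.TwoClocks

/-! ### Chernoff's bound in `lintegral` currency -/

/-- **Chernoff / exponential Markov inequality** for an arbitrary measure, in `lintegral` currency: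
for an a.e.-measurable real `f`, a tilt `β > 0` and a level `t`,
`μ{t ≤ f} ≤ exp(-βt) · ∫ exp(β f) dμ` (Markov's inequality `mul_meas_ge_le_lintegral₀` for
`exp(β f)` at the level `exp(βt)`). [folklore] -/
theorem measure_le_exp_neg_mul_lintegral_exp {α : Type*} [MeasurableSpace α] (μ : Measure α)
    {f : α → ℝ} (hf : AEMeasurable f μ) {β : ℝ} (hβ : 0 < β) (t : ℝ) :
    μ {x | t ≤ f x} ≤
      ENNReal.ofReal (Real.exp (-(β * t))) * ∫⁻ x, ENNReal.ofReal (Real.exp (β * f x)) ∂μ := by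
  set c : ℝ≥0∞ := ENNReal.ofReal (Real.exp (β * t)) with hc
  have hg : AEMeasurable (fun x => ENNReal.ofReal (Real.exp (β * f x))) μ :=
    (Real.measurable_exp.comp_aemeasurable (hf.const_mul β)).ennreal_ofReal
  have hsub : {x | t ≤ f x} ⊆ {x | c ≤ ENNReal.ofReal (Real.exp (β * f x))} := by
    intro x hx
    simp only [Set.mem_setOf_eq] at hx ⊢
    exact ENNReal.ofReal_le_ofReal (Real.exp_le_exp.2 (mul_le_mul_of_nonneg_left hx hβ.le))
  have hinv : ENNReal.ofReal (Real.exp (-(β * t))) * c = 1 := by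
    rw [hc, ← ENNReal.ofReal_mul (Real.exp_pos _).le, ← Real.exp_add, neg_add_cancel,
      Real.exp_zero, ENNReal.ofReal_one]
  calc μ {x | t ≤ f x} ≤ μ {x | c ≤ ENNReal.ofReal (Real.exp (β * f x))} := measure_mono hsub
    _ = ENNReal.ofReal (Real.exp (-(β * t))) *
          (c * μ {x | c ≤ ENNReal.ofReal (Real.exp (β * f x))}) := by
        rw [← mul_assoc, hinv, one_mul]
    _ ≤ ENNReal.ofReal (Real.exp (-(β * t))) * ∫⁻ x, ENNReal.ofReal (Real.exp (β * f x)) ∂μ :=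
        mul_le_mul_right (mul_meas_ge_le_lintegral₀ hg c) _

/-- **Chernoff's bound from an exponential-moment bound**: if `∫ exp(β f) dμ ≤ exp B` with `β > 0`,
then `μ{t ≤ f} ≤ exp(B - βt)` for every level `t`. [folklore] -/
theorem measure_le_exp_of_lintegral_exp_le {α : Type*} [MeasurableSpace α] {μ : Measure α}
    {f : α → ℝ} (hf : AEMeasurable f μ) {β : ℝ} (hβ : 0 < β) (t : ℝ) {B : ℝ}
    (h : ∫⁻ x, ENNReal.ofReal (Real.exp (β * f x)) ∂μ ≤ ENNReal.ofReal (Real.exp B)) :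
    μ {x | t ≤ f x} ≤ ENNReal.ofReal (Real.exp (B - β * t)) := by
  calc μ {x | t ≤ f x}
      ≤ ENNReal.ofReal (Real.exp (-(β * t))) * ∫⁻ x, ENNReal.ofReal (Real.exp (β * f x)) ∂μ :=
        measure_le_exp_neg_mul_lintegral_exp μ hf hβ t
    _ ≤ ENNReal.ofReal (Real.exp (-(β * t))) * ENNReal.ofReal (Real.exp B) :=
        mul_le_mul_right h _
    _ = ENNReal.ofReal (Real.exp (B - β * t)) := by
        rw [← ENNReal.ofReal_mul (Real.exp_pos _).le, ← Real.exp_add]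
        ring_nf

/-- **Chernoff's bound for the lower tail**: if `∫ exp((-β) f) dμ ≤ exp B` with `β > 0`, then
`μ{f ≤ -t} ≤ exp(B - βt)` (the upper-tail bound for `-f` at the tilt `β`). [folklore] -/
theorem measure_le_neg_le_exp_of_lintegral_exp_le {α : Type*} [MeasurableSpace α] {μ : Measure α}
    {f : α → ℝ} (hf : AEMeasurable f μ) {β : ℝ} (hβ : 0 < β) (t : ℝ) {B : ℝ}
    (h : ∫⁻ x, ENNReal.ofReal (Real.exp ((-β) * f x)) ∂μ ≤ ENNReal.ofReal (Real.exp B)) :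
    μ {x | f x ≤ -t} ≤ ENNReal.ofReal (Real.exp (B - β * t)) := by
  have hset : {x | f x ≤ -t} = {x | t ≤ -f x} := by
    ext x
    simp only [Set.mem_setOf_eq]
    constructor <;> intro hx <;> linarith
  have h' : ∫⁻ x, ENNReal.ofReal (Real.exp (β * (-f x))) ∂μ ≤ ENNReal.ofReal (Real.exp B) := by
    refine le_of_eq_of_le (lintegral_congr fun x => ?_) h
    rw [mul_neg, neg_mul]
  rw [hset]
  exact measure_le_exp_of_lintegral_exp_le hf.neg hβ t h'

/-! ### The item implies exponential concentration of the window shear stress -/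

/-- **`EquilibriumShearWindowLD` ⇒ exponential concentration of the window kinetic shear stress at
every linear scale, with a rate linear in the level.** If the item holds then, with its `σ₀` and for all
its parameters `a₀, θ₀, σ, Φ, φ`, there is `c > 0` (`= β₀/2`, half the item's tilt range) such that for
every level `δ > 0` there is a window threshold `τ₀` with: for every `τ ≥ τ₀`, eventually in `N`,
`G_N{z : δ(N+1) ≤ |W_{N,τ}(z)|} ≤ 2 exp(-cδ(N+1))`, where
`W_{N,τ}(z) = ∑ᵢ w⁻¹∫₀ʷ φ(xᵢ(r)) vᵢ⁰(r) vᵢ¹(r) dr`, `w = τ(N+1)^{-1/3}`. (All-windows form of the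
item at the tilts `±β₀` with `ε = β₀δ/2`, then Chernoff for each tail and a union bound.) [folklore] -/
theorem equilibriumShearWindowLD_concentration (h : EquilibriumShearWindowLD) :
    ∃ σ₀ : ℝ, 0 < σ₀ ∧ ∀ (a₀ θ₀ : ℝ), 0 < a₀ → 0 < θ₀ → ∀ σ : ℝ, 0 < σ → σ < σ₀ →
      ∀ Φ : (N : ℕ) → HardSphereFlow (Torus.geometry (Fin 3)) (hsDiameter σ N) (N + 1),
      ∀ φ : T3 → ℝ, Continuous φ → ∃ c : ℝ, 0 < c ∧ ∀ δ : ℝ, 0 < δ →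
        ∃ τ₀ : ℝ, 0 < τ₀ ∧ ∀ τ : ℝ, τ₀ ≤ τ → ∃ N₀ : ℕ, ∀ N : ℕ, N₀ ≤ N →
          localGibbsLaw σ (fun _ => a₀) (fun _ => 0) (fun _ => θ₀) N (Φ N)
              {z | δ * ((N : ℝ) + 1) ≤ |∑ i : Fin (N + 1), (τ * ((N : ℝ) + 1) ^ (-(1 / 3 : ℝ)))⁻¹ *
                  ∫ r in (0 : ℝ)..(τ * ((N : ℝ) + 1) ^ (-(1 / 3 : ℝ))),
                    φ ((Φ N).flow r z i).1 * (((Φ N).flow r z i).2 0 * ((Φ N).flow r z i).2 1)|} ≤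
            2 * ENNReal.ofReal (Real.exp (-(c * δ * ((N : ℝ) + 1)))) := by
  obtain ⟨σ₀, hσ₀, H⟩ := equilibriumShearWindowLD_iff_allWindows.1 h
  refine ⟨σ₀, hσ₀, fun a₀ θ₀ ha hθ σ hσ hσσ Φ φ hφ => ?_⟩
  obtain ⟨β₀, hβ₀, hβ⟩ := H a₀ θ₀ ha hθ σ hσ hσσ Φ φ hφ
  refine ⟨β₀ / 2, half_pos hβ₀, fun δ hδ => ?_⟩
  have hε : 0 < β₀ * δ / 2 := by positivity
  obtain ⟨τ₁, hτ₁, h₁⟩ := hβ β₀ (by rw [abs_of_pos hβ₀]) (β₀ * δ / 2) hε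
  obtain ⟨τ₂, hτ₂, h₂⟩ := hβ (-β₀) (by rw [abs_neg, abs_of_pos hβ₀]) (β₀ * δ / 2) hε
  refine ⟨max τ₁ τ₂, lt_max_of_lt_left hτ₁, fun τ hτ => ?_⟩
  obtain ⟨N₁, hN₁⟩ := h₁ τ ((le_max_left _ _).trans hτ)
  obtain ⟨N₂, hN₂⟩ := h₂ τ ((le_max_right _ _).trans hτ)
  refine ⟨max N₁ N₂, fun N hN => ?_⟩
  set μ := localGibbsLaw σ (fun _ => a₀) (fun _ => 0) (fun _ => θ₀) N (Φ N) with hμ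
  set w : ℝ := τ * ((N : ℝ) + 1) ^ (-(1 / 3 : ℝ)) with hw
  set W : Config (N + 1) (Fin 3) T3 → ℝ := fun z => ∑ i : Fin (N + 1), w⁻¹ *
      ∫ r in (0 : ℝ)..w, φ ((Φ N).flow r z i).1 * (((Φ N).flow r z i).2 0 * ((Φ N).flow r z i).2 1)
    with hW
  have hWm : AEMeasurable W μ := aemeasurable_shearWindowSum σ a₀ θ₀ N (Φ N) hφ w
  have hup : μ {z | δ * ((N : ℝ) + 1) ≤ W z} ≤
      ENNReal.ofReal (Real.exp (β₀ * δ / 2 * ((N : ℝ) + 1) - β₀ * (δ * ((N : ℝ) + 1)))) :=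
    measure_le_exp_of_lintegral_exp_le hWm hβ₀ _ (hN₁ N ((le_max_left _ _).trans hN))
  have hlow : μ {z | W z ≤ -(δ * ((N : ℝ) + 1))} ≤
      ENNReal.ofReal (Real.exp (β₀ * δ / 2 * ((N : ℝ) + 1) - β₀ * (δ * ((N : ℝ) + 1)))) :=
    measure_le_neg_le_exp_of_lintegral_exp_le hWm hβ₀ _ (hN₂ N ((le_max_right _ _).trans hN))
  have hexp : Real.exp (β₀ * δ / 2 * ((N : ℝ) + 1) - β₀ * (δ * ((N : ℝ) + 1))) =
      Real.exp (-(β₀ / 2 * δ * ((N : ℝ) + 1))) := by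
    congr 1; ring
  rw [hexp] at hup hlow
  have hsub : {z | δ * ((N : ℝ) + 1) ≤ |W z|} ⊆
      {z | δ * ((N : ℝ) + 1) ≤ W z} ∪ {z | W z ≤ -(δ * ((N : ℝ) + 1))} := by
    intro z hz
    simp only [Set.mem_setOf_eq, Set.mem_union] at hz ⊢
    rcases le_or_gt 0 (W z) with h0 | h0
    · left; rwa [abs_of_nonneg h0] at hz
    · right; rw [abs_of_neg h0] at hz; linarith
  calc μ {z | δ * ((N : ℝ) + 1) ≤ |W z|}
      ≤ μ ({z | δ * ((N : ℝ) + 1) ≤ W z} ∪ {z | W z ≤ -(δ * ((N : ℝ) + 1))}) := measure_mono hsub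
    _ ≤ μ {z | δ * ((N : ℝ) + 1) ≤ W z} + μ {z | W z ≤ -(δ * ((N : ℝ) + 1))} :=
        measure_union_le _ _
    _ ≤ ENNReal.ofReal (Real.exp (-(β₀ / 2 * δ * ((N : ℝ) + 1)))) +
          ENNReal.ofReal (Real.exp (-(β₀ / 2 * δ * ((N : ℝ) + 1)))) := add_le_add hup hlow
    _ = 2 * ENNReal.ofReal (Real.exp (-(β₀ / 2 * δ * ((N : ℝ) + 1)))) := by rw [two_mul]

/-! ### The refutation dock: a slow stress mode kills the item (and the route) -/

/-- **A slow-stress-mode witness refutes `EquilibriumShearWindowLD`.** Suppose that at reduced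
diameters accumulating at `0` (for every `σ₀ > 0` some `σ ∈ (0, σ₀)`), for some activity `a₀ > 0`,
temperature `θ₀ > 0`, flow family `Φ` and continuous `φ`, the following holds: for every tilt `β > 0`
there are a level `δ` and a cost rate `I < βδ` such that, at EVERY window parameter `τ > 0` and for
infinitely many `N`, the global Gibbs probability of the window kinetic shear stress
`W_{N,τ} = ∑ᵢ w⁻¹∫₀ʷ φ(xᵢ) vᵢ⁰vᵢ¹` exceeding `δ(N+1)` is at least `exp(-I(N+1))`. Then the item is
false: Chernoff gives `∫ exp(β₀ W) dG_N ≥ exp((β₀δ - I)(N+1))` along that sequence at the item's own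
tilt `β₀` and window, contradicting the bound `exp(ε(N+1))` at `ε = (β₀δ - I)/2`. (A lower-tail
witness is an upper-tail witness for `-φ`.) This is the typed form of the route's KILL CRITERION
"a hidden slow stress mode of the deterministic gas": stress `δ` per particle sustained over every
finite kinetic window at large-deviation cost below `βδ` for every `β > 0`. [folklore] -/
theorem not_equilibriumShearWindowLD_of_slowStressMode
    (h : ∀ σ₀ : ℝ, 0 < σ₀ → ∃ σ : ℝ, 0 < σ ∧ σ < σ₀ ∧ ∃ a₀ θ₀ : ℝ, 0 < a₀ ∧ 0 < θ₀ ∧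
      ∃ Φ : (N : ℕ) → HardSphereFlow (Torus.geometry (Fin 3)) (hsDiameter σ N) (N + 1),
      ∃ φ : T3 → ℝ, Continuous φ ∧ ∀ β : ℝ, 0 < β → ∃ δ I : ℝ, I < β * δ ∧
        ∀ τ : ℝ, 0 < τ → ∀ N₀ : ℕ, ∃ N : ℕ, N₀ ≤ N ∧
          ENNReal.ofReal (Real.exp (-(I * ((N : ℝ) + 1)))) ≤
            localGibbsLaw σ (fun _ => a₀) (fun _ => 0) (fun _ => θ₀) N (Φ N)
              {z | δ * ((N : ℝ) + 1) ≤ ∑ i : Fin (N + 1), (τ * ((N : ℝ) + 1) ^ (-(1 / 3 : ℝ)))⁻¹ *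
                  ∫ r in (0 : ℝ)..(τ * ((N : ℝ) + 1) ^ (-(1 / 3 : ℝ))),
                    φ ((Φ N).flow r z i).1 * (((Φ N).flow r z i).2 0 * ((Φ N).flow r z i).2 1)}) :
    ¬ EquilibriumShearWindowLD := by
  rintro ⟨σ₀, hσ₀, H⟩
  obtain ⟨σ, hσ, hσσ, a₀, θ₀, ha, hθ, Φ, φ, hφ, hw⟩ := h σ₀ hσ₀
  obtain ⟨β₀, hβ₀, hβ⟩ := H a₀ θ₀ ha hθ σ hσ hσσ Φ φ hφ
  obtain ⟨δ, I, hI, hw⟩ := hw β₀ hβ₀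
  have hε : 0 < (β₀ * δ - I) / 2 := by linarith
  obtain ⟨τ, hτ, N₀, hN⟩ := hβ β₀ (by rw [abs_of_pos hβ₀]) ((β₀ * δ - I) / 2) hε
  obtain ⟨N, hNN, hlow⟩ := hw τ hτ N₀
  set μ := localGibbsLaw σ (fun _ => a₀) (fun _ => 0) (fun _ => θ₀) N (Φ N) with hμ
  set w : ℝ := τ * ((N : ℝ) + 1) ^ (-(1 / 3 : ℝ)) with hwdef
  set W : Config (N + 1) (Fin 3) T3 → ℝ := fun z => ∑ i : Fin (N + 1), w⁻¹ *
      ∫ r in (0 : ℝ)..w, φ ((Φ N).flow r z i).1 * (((Φ N).flow r z i).2 0 * ((Φ N).flow r z i).2 1)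
    with hW
  have hWm : AEMeasurable W μ := aemeasurable_shearWindowSum σ a₀ θ₀ N (Φ N) hφ w
  have hup : μ {z | δ * ((N : ℝ) + 1) ≤ W z} ≤
      ENNReal.ofReal (Real.exp ((β₀ * δ - I) / 2 * ((N : ℝ) + 1) - β₀ * (δ * ((N : ℝ) + 1)))) :=
    measure_le_exp_of_lintegral_exp_le hWm hβ₀ _ (hN N hNN)
  have hcmp := (ENNReal.ofReal_le_ofReal_iff (Real.exp_pos _).le).1 (hlow.trans hup)
  rw [Real.exp_le_exp] at hcmp
  have hN1 : (0 : ℝ) < (N : ℝ) + 1 := by positivity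
  nlinarith

/-- **The same witness kills the crux `EquilibriumFastWindowLD`** (stmt-AtomisticToContinuum-14440),
through `equilibriumShearWindowLD_of_equilibriumFastWindowLD`: the typed KILL edge of route TwoClocks.
[folklore] -/
theorem not_equilibriumFastWindowLD_of_slowStressMode
    (h : ∀ σ₀ : ℝ, 0 < σ₀ → ∃ σ : ℝ, 0 < σ ∧ σ < σ₀ ∧ ∃ a₀ θ₀ : ℝ, 0 < a₀ ∧ 0 < θ₀ ∧
      ∃ Φ : (N : ℕ) → HardSphereFlow (Torus.geometry (Fin 3)) (hsDiameter σ N) (N + 1),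
      ∃ φ : T3 → ℝ, Continuous φ ∧ ∀ β : ℝ, 0 < β → ∃ δ I : ℝ, I < β * δ ∧
        ∀ τ : ℝ, 0 < τ → ∀ N₀ : ℕ, ∃ N : ℕ, N₀ ≤ N ∧
          ENNReal.ofReal (Real.exp (-(I * ((N : ℝ) + 1)))) ≤
            localGibbsLaw σ (fun _ => a₀) (fun _ => 0) (fun _ => θ₀) N (Φ N)
              {z | δ * ((N : ℝ) + 1) ≤ ∑ i : Fin (N + 1), (τ * ((N : ℝ) + 1) ^ (-(1 / 3 : ℝ)))⁻¹ *
                  ∫ r in (0 : ℝ)..(τ * ((N : ℝ) + 1) ^ (-(1 / 3 : ℝ))),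
                    φ ((Φ N).flow r z i).1 * (((Φ N).flow r z i).2 0 * ((Φ N).flow r z i).2 1)}) :
    ¬ EquilibriumFastWindowLD := fun hF =>
  not_equilibriumShearWindowLD_of_slowStressMode h (equilibriumShearWindowLD_of_equilibriumFastWindowLD hF)

/-- **The same witness kills the docking node `KineticWindowLDUniform`**
(stmt-AtomisticToContinuum-14442), through `equilibriumShearWindowLD_of_kineticWindowLDUniform`.
[folklore] -/
theorem not_kineticWindowLDUniform_of_slowStressMode
    (h : ∀ σ₀ : ℝ, 0 < σ₀ → ∃ σ : ℝ, 0 < σ ∧ σ < σ₀ ∧ ∃ a₀ θ₀ : ℝ, 0 < a₀ ∧ 0 < θ₀ ∧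
      ∃ Φ : (N : ℕ) → HardSphereFlow (Torus.geometry (Fin 3)) (hsDiameter σ N) (N + 1),
      ∃ φ : T3 → ℝ, Continuous φ ∧ ∀ β : ℝ, 0 < β → ∃ δ I : ℝ, I < β * δ ∧
        ∀ τ : ℝ, 0 < τ → ∀ N₀ : ℕ, ∃ N : ℕ, N₀ ≤ N ∧
          ENNReal.ofReal (Real.exp (-(I * ((N : ℝ) + 1)))) ≤
            localGibbsLaw σ (fun _ => a₀) (fun _ => 0) (fun _ => θ₀) N (Φ N)
              {z | δ * ((N : ℝ) + 1) ≤ ∑ i : Fin (N + 1), (τ * ((N : ℝ) + 1) ^ (-(1 / 3 : ℝ)))⁻¹ *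
                  ∫ r in (0 : ℝ)..(τ * ((N : ℝ) + 1) ^ (-(1 / 3 : ℝ))),
                    φ ((Φ N).flow r z i).1 * (((Φ N).flow r z i).2 0 * ((Φ N).flow r z i).2 1)}) :
    ¬ KineticWindowLDUniform := fun hK =>
  not_equilibriumShearWindowLD_of_slowStressMode h (equilibriumShearWindowLD_of_kineticWindowLDUniform hK)

/-- **The same witness kills the sibling node `OneFlightGossipEngine.KineticCurrentsWindowLDUniform`**
(stmt-AtomisticToContinuum-14662), through `equilibriumShearWindowLD_of_kineticCurrentsWindowLDUniform`:
the route text's "moots KineticCurrentsWindowLD-based plans elsewhere". [folklore] -/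
theorem not_kineticCurrentsWindowLDUniform_of_slowStressMode
    (h : ∀ σ₀ : ℝ, 0 < σ₀ → ∃ σ : ℝ, 0 < σ ∧ σ < σ₀ ∧ ∃ a₀ θ₀ : ℝ, 0 < a₀ ∧ 0 < θ₀ ∧
      ∃ Φ : (N : ℕ) → HardSphereFlow (Torus.geometry (Fin 3)) (hsDiameter σ N) (N + 1),
      ∃ φ : T3 → ℝ, Continuous φ ∧ ∀ β : ℝ, 0 < β → ∃ δ I : ℝ, I < β * δ ∧
        ∀ τ : ℝ, 0 < τ → ∀ N₀ : ℕ, ∃ N : ℕ, N₀ ≤ N ∧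
          ENNReal.ofReal (Real.exp (-(I * ((N : ℝ) + 1)))) ≤
            localGibbsLaw σ (fun _ => a₀) (fun _ => 0) (fun _ => θ₀) N (Φ N)
              {z | δ * ((N : ℝ) + 1) ≤ ∑ i : Fin (N + 1), (τ * ((N : ℝ) + 1) ^ (-(1 / 3 : ℝ)))⁻¹ *
                  ∫ r in (0 : ℝ)..(τ * ((N : ℝ) + 1) ^ (-(1 / 3 : ℝ))),
                    φ ((Φ N).flow r z i).1 * (((Φ N).flow r z i).2 0 * ((Φ N).flow r z i).2 1)}) :
    ¬ Summit.AtomisticToContinuum.HydrodynamicLimit.Theses.OneFlightGossipEngine.KineticCurrentsWindowLDUniform :=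
  fun hK => not_equilibriumShearWindowLD_of_slowStressMode h
    (equilibriumShearWindowLD_of_kineticCurrentsWindowLDUniform hK)

end Summit.AtomisticToContinuum.HydrodynamicLimit.Theorems

end
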